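import Literature.Analysis.OperatorTheory.Enflo2023.CaseI
import HarnessLib

/-!
# Enflo (2023), Part A p.12: the PRINTED (25) holds for THE minimiser — the Lagrange-identity coordinate ratio

Source under adjudication: Per H. Enflo, *On the invariant subspace problem in Hilbert spaces*, arXiv:2305.15442
(v2, 2024), bib key `Enflo2023`.  [cite: Enflo2023, v2 p.12, Case I and eq. (25) (tex L386–L399): "Case I.
`|⟨T^j y₁', x₀ − y₁'⟩| ≥ (εθ)⁴` for some `j`. Then … for `inf Σ_{j≥0}|a_j|²` in `‖Σ_{j≥0} a_j T^j y₁' − x₀‖ ≤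
‖x₀ − y₁'‖` we have (25) `Σ_{j≥1}|a_j|² ≥ (εθ)^{15}`."; v2 p.3, eq. (5): the Lagrange identity
`V†(x₀ − Vℓ') = C'ℓ'` of the minimal solution of (1).]

This module is os-F3b / BLOCK-2b repair-cell work (`pub-enflo`): kernel-checked statements ABOUT one step of the
manuscript (formaliser 1, Part A).  NOTHING here asserts the manuscript's main theorem; no declaration concludes
the invariant subspace problem for an arbitrary operator.

WHAT IS PROVED.  `CaseI.lean` derived from the text's displayed competitor only
`‖Lc‖ = (Σ_{j≥1}|c_j|²)^{1/2} ≥ 0.98·10²⁰(εθ)^{11}` (`CaseI.tail_lower_bound_of_caseI`), whence the printed exponent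
`15` of (25) only for `εθ ≥ 2·10⁻⁶` (`CaseI.eq25_printed_of_caseI`), and the packet recorded (25) as a slip
"exponent `15 → 22`".  Here the printed (25) is DECIDED for THE minimiser on the whole range `0 < εθ ≤ 10⁻³` of the
construction: it is TRUE, and the order the Lagrange identity gives for the tail is `(εθ)³` (Case I's exponent
`4` minus one; note Case I itself forces `(εθ)⁴ ≤ ‖T^j y‖ ≤ 10⁻²⁰`, i.e. `εθ ≤ 10⁻⁵`).  Setting (as in `CaseI.lean`,
the text's own constants): `‖T‖ ≤ 10⁻²⁰`, `⟨x₀ − y, y⟩ = εθ` real, `‖y‖ ≤ 1`, `‖x₀ − y‖ ≤ 1`, `‖x₀ − y‖ < ‖x₀‖`,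
`c` THE minimal solution of (1) for `V_y` at radius `‖x₀ − y‖` (the infimum in (25)); `R = x₀ − V_y c`,
`d = 1 − c₀`, `w₁ = Σ_{j≥1} c_j T^j y` (`‖w₁‖ ≤ 1.0001·10⁻²⁰‖Lc‖`, `Vy.norm_V_sub_head_le`).
* `CaseI.kkt_ratio_core` — the bookkeeping, for any `j ≥ 1`.  The Lagrange identity (5) in coordinates
  (`Vy.kkt_coord`, from `IsMinimal.kkt`) reads `⟨T^j y, R⟩ = C c_j` for ALL `j`, hence the exact ratio
  `|c_j|·|⟨y, R⟩| = |c₀|·|⟨T^j y, R⟩|`; the activity identity (`CaseI.activity_identity`, with `‖c‖ ≤ 1`) gives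
  `εθ·Re d ≤ ‖w₁‖`, the `j = 0` coordinate of (5) (imaginary part) gives `‖y‖·|Im d| ≤ ‖w₁‖`, so `εθ·|d| ≤ 2‖w₁‖`;
  and `|⟨y, R⟩| ≤ εθ + |d| + ‖w₁‖`, `|⟨T^j y, R⟩| ≥ |⟨x₀ − y, T^j y⟩| − 10⁻²⁰(|d| + ‖w₁‖)`, `|c_j| ≤ ‖Lc‖`.
* `CaseI.tail_ge_pow_five_of_caseI` — Case I at some `j ≥ 1` (`|⟨x₀ − y, T^j y⟩| ≥ (εθ)⁴`) forces
  `‖Lc‖ ≥ (εθ)⁵` for ALL `0 < εθ ≤ 10⁻³`: were `‖Lc‖ < (εθ)⁵`, the junk terms are `≤ 4·10⁻²⁰(εθ)⁴` and the ratio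
  gives `|c_j| ≥ 0.99(εθ)³ > ‖Lc‖ ≥ |c_j|`.
* `CaseI.eq25_printed_of_caseI_all` — hence the PRINTED (25), `Σ_{j≥1}|c_j|² ≥ (εθ)^{15}`, for all
  `0 < εθ ≤ 10⁻³` (indeed `≥ (εθ)^{10}`), superseding the range restriction of `CaseI.eq25_printed_of_caseI`.
* `CaseI.tail_ge_cube_of_caseI` — the cubic order: `‖Lc‖ ≥ 0.99(εθ)³` for `10⁻¹⁸ ≤ εθ ≤ 10⁻³`.
VERDICT for the record (packet STEPS A24/A33, census F1-V12 (b)): the displayed DERIVATION of (25) (competitor plus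
"`(1 − (εθ)'')² + ((εθ)⁶)² < 1`") yields only exponent `22`; the STATEMENT (25) as printed is nevertheless a theorem
about the minimiser, by the Lagrange identity (5) which the text has available (pp.3–4) but does not invoke at this
point.  Downstream ((33), v2 p.15) only some explicit positive lower bound for the tail is consumed, so nothing in the
assessment of Part B changes.

Origin: planner-b2b-enflo-1-g15-0 (F1 gen-15), 2026-08-19.
-/

noncomputable section

open scoped InnerProductSpace ENNReal ComplexConjugate
open Literature.Analysis.UnboundedOperators (inner_self_eq_coe_norm_sq)

namespace Literature.Analysis.OperatorTheory.Enflo2023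

variable {H : Type*} [NormedAddCommGroup H] [InnerProductSpace ℂ H] [CompleteSpace H]

namespace CaseI

open Vy CaseII

/-- **The Lagrange-identity coordinate ratio for THE minimiser (bookkeeping).**  `‖T‖ ≤ 10⁻²⁰`,
`⟨x₀ − y, y⟩ = εθ > 0` (real), `‖y‖ ≤ 1`, `‖x₀ − y‖ ≤ 1`, `‖x₀ − y‖ < ‖x₀‖`, `j ≥ 1`; `c` THE minimal solution of
(1) for `V_y` at radius `‖x₀ − y‖`, `R = x₀ − V_y c`.  There are `u = ‖w₁‖` (`w₁ = Σ_{i≥1} c_i T^i y`) and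
`δ = |1 − c₀|` with: `u ≤ 1.0001·10⁻²⁰‖Lc‖`, `εθ·δ ≤ 2u`, `|c₀| ≥ 1 − δ`, `|⟨y, R⟩| ≤ εθ + δ + u`,
`|⟨T^j y, R⟩| ≥ |⟨x₀ − y, T^j y⟩| − 10⁻²⁰(δ + u)`, the exact ratio `|c_j|·|⟨y, R⟩| = |c₀|·|⟨T^j y, R⟩|`
(both sides equal `C|c₀||c_j|` by (5): `⟨T^i y, R⟩ = C c_i` for all `i`), and `|c_j| ≤ ‖Lc‖`. [cite: Enflo2023, v2 p.3, eq. (5); p.12, Case I and eq. (25) (tex L386–L399)] -/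
theorem kkt_ratio_core (T : H →L[ℂ] H) (hT1 : ‖T‖ < 1) (hT : ‖T‖ ≤ 1 / 10 ^ 20) (x₀ y : H) (t : ℝ)
    (ht : ⟪x₀ - y, y⟫_ℂ = t) (ht0 : 0 < t) (hy1 : ‖y‖ ≤ 1) (hxy : ‖x₀ - y‖ ≤ 1) (hlt : ‖x₀ - y‖ < ‖x₀‖)
    {j : ℕ} (hj : 1 ≤ j) {c : ℓ2} (hc : IsMinimal (V T hT1 y) x₀ ‖x₀ - y‖ c) :
    ∃ u δ : ℝ, 0 ≤ u ∧ u ≤ 1 / 10 ^ 20 * (1 + 1 / 10 ^ 4) * ‖L c‖ ∧ 0 ≤ δ ∧ t * δ ≤ 2 * u ∧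
      1 - δ ≤ ‖c 0‖ ∧
      ‖⟪y, x₀ - V T hT1 y c⟫_ℂ‖ ≤ t + δ + u ∧
      ‖⟪x₀ - y, (T ^ j) y⟫_ℂ‖ - 1 / 10 ^ 20 * (δ + u) ≤ ‖⟪(T ^ j) y, x₀ - V T hT1 y c⟫_ℂ‖ ∧
      ‖c j‖ * ‖⟪y, x₀ - V T hT1 y c⟫_ℂ‖ = ‖c 0‖ * ‖⟪(T ^ j) y, x₀ - V T hT1 y c⟫_ℂ‖ ∧
      ‖c j‖ ≤ ‖L c‖ := by
  -- the Lagrange identity (5) in coordinates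
  have hc_ne : c ≠ 0 := hc.ne_zero hlt
  obtain ⟨C, hC0, hC⟩ := hc.kkt hc_ne
  have hk : ∀ i : ℕ, ⟪(T ^ i) y, x₀ - V T hT1 y c⟫_ℂ = (C : ℂ) * c i :=
    fun i => kkt_coord T hT1 y x₀ c hC i
  have hk0 : ⟪y, x₀ - V T hT1 y c⟫_ℂ = (C : ℂ) * c 0 := by
    have h := hk 0
    rwa [pow_zero, one_apply_eq_self] at h
  -- the tail `w₁` and its size
  have hw : ‖V T hT1 y (S (L c))‖ ≤ 1 / 10 ^ 20 * (1 + 1 / 10 ^ 4) * ‖L c‖ := by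
    have h := norm_V_sub_head_le T hT1 y c
    rw [V_decomp T hT1 y c, add_sub_cancel_left, ← V_shift] at h
    calc ‖V T hT1 y (S (L c))‖ ≤ ‖T‖ * (‖y‖ * Real.sqrt (1 / (1 - ‖T‖ ^ 2))) * ‖L c‖ := h
      _ ≤ 1 / 10 ^ 20 * (1 + 1 / 10 ^ 4) * ‖L c‖ := by
          gcongr
          exact norm_y_mul_sqrt_le hT hy1
  -- the activity identity (the constraint of (1) is active)
  have hact := activity_identity T hT1 x₀ y t ht hlt hc
  set w₁ := V T hT1 y (S (L c)) with hw₁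
  set d : ℂ := 1 - c 0 with hd
  set R := x₀ - V T hT1 y c with hR
  have hVc : V T hT1 y c = c 0 • y + w₁ := by rw [hw₁, V_shift]; exact V_decomp T hT1 y c
  have hsplit : R = (x₀ - y) + (d • y - w₁) := by
    rw [hR, hVc, hd, sub_smul, one_smul]; abel
  -- `εθ ≤ ‖y‖` (so `y ≠ 0`)
  have hynorm : t ≤ ‖y‖ := by
    have h1 : ‖⟪x₀ - y, y⟫_ℂ‖ ≤ ‖x₀ - y‖ * ‖y‖ := norm_inner_le_norm _ _
    rw [ht, Complex.norm_real, Real.norm_of_nonneg ht0.le] at h1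
    exact h1.trans (mul_le_of_le_one_left (norm_nonneg _) hxy)
  have hypos : 0 < ‖y‖ := lt_of_lt_of_le ht0 hynorm
  -- `‖c‖ ≤ 1`, hence `Re d ≥ 0`
  have hc1 : ‖c‖ ≤ 1 := norm_minimal_le_one T hT1 y x₀ _ c hc le_rfl
  have hc01 : ‖c 0‖ ≤ 1 := (lp.norm_apply_le_norm (by norm_num) c 0).trans hc1
  have hdre_eq : d.re = 1 - (c 0).re := by rw [hd, Complex.sub_re, Complex.one_re]
  have hdre0 : 0 ≤ d.re := by
    have : (c 0).re ≤ 1 := ((le_abs_self _).trans (Complex.abs_re_le_norm _)).trans hc01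
    rw [hdre_eq]; linarith only [this]
  -- `εθ · Re d ≤ ‖w₁‖` from the activity identity
  have hpair : (⟪x₀ - y, w₁⟫_ℂ).re ≤ ‖w₁‖ := by
    refine (le_abs_self _).trans ((Complex.abs_re_le_norm _).trans ?_)
    exact (norm_inner_le_norm _ _).trans (mul_le_of_le_one_left (norm_nonneg _) hxy)
  have hdre : t * d.re ≤ ‖w₁‖ := by
    rw [hdre_eq]
    linarith only [hact, hpair, sq_nonneg ‖d • y - w₁‖]
  -- `‖y‖ · |Im d| ≤ ‖w₁‖` from the `j = 0` coordinate of (5)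
  have hyx : ⟪y, x₀ - y⟫_ℂ = (t : ℂ) := by rw [← inner_conj_symm, ht, Complex.conj_ofReal]
  have hyy : ⟪y, y⟫_ℂ = ((‖y‖ ^ 2 : ℝ) : ℂ) := inner_self_eq_coe_norm_sq y
  have hinner0 : ⟪y, R⟫_ℂ = (t : ℂ) + d * ((‖y‖ ^ 2 : ℝ) : ℂ) - ⟪y, w₁⟫_ℂ := by
    rw [hsplit, inner_add_right, hyx, inner_sub_right, inner_smul_right, hyy, add_sub_assoc']
  have hkkt0 : d * ((‖y‖ ^ 2 : ℝ) : ℂ) + d * (C : ℂ) = (C : ℂ) - (t : ℂ) + ⟪y, w₁⟫_ℂ := by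
    have h1 : (C : ℂ) * c 0 = (C : ℂ) * (1 - d) := by rw [hd]; ring
    have h2 := hk0
    rw [hinner0] at h2
    linear_combination h2 + h1
  have him : d.im * (‖y‖ ^ 2 + C) = (⟪y, w₁⟫_ℂ).im := by
    have h := congrArg Complex.im hkkt0
    simp only [Complex.add_im, Complex.sub_im, Complex.mul_im, Complex.ofReal_re, Complex.ofReal_im,
      mul_zero, zero_add, sub_self] at h
    linear_combination h
  have hdim : ‖y‖ * |d.im| ≤ ‖w₁‖ := by
    have h1 : |(⟪y, w₁⟫_ℂ).im| ≤ ‖y‖ * ‖w₁‖ := (Complex.abs_im_le_norm _).trans (norm_inner_le_norm y w₁)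
    have h2 : |d.im| * (‖y‖ ^ 2 + C) ≤ ‖y‖ * ‖w₁‖ := by
      rw [← abs_of_nonneg (by positivity : (0 : ℝ) ≤ ‖y‖ ^ 2 + C), ← abs_mul, him]; exact h1
    have h3 : ‖y‖ * (‖y‖ * |d.im|) ≤ ‖y‖ * ‖w₁‖ := by
      linarith only [h2, mul_nonneg (abs_nonneg d.im) hC0]
    exact le_of_mul_le_mul_left h3 hypos
  -- hence `εθ · |d| ≤ 2‖w₁‖`
  have htδ : t * ‖d‖ ≤ 2 * ‖w₁‖ := by
    have h1 : ‖d‖ ≤ |d.re| + |d.im| := Complex.norm_le_abs_re_add_abs_im d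
    rw [abs_of_nonneg hdre0] at h1
    have h2 : t * |d.im| ≤ ‖w₁‖ := (mul_le_mul_of_nonneg_right hynorm (abs_nonneg _)).trans hdim
    linarith only [mul_le_mul_of_nonneg_left h1 ht0.le, hdre, h2]
  -- `|c₀| ≥ 1 − |d|`
  have hc0' : 1 - ‖d‖ ≤ ‖c 0‖ := by
    have h0 : c 0 = 1 - d := by rw [hd]; ring
    have h := norm_sub_norm_le (1 : ℂ) d
    rw [norm_one, ← h0] at h
    exact h
  -- `|⟨y, R⟩| ≤ εθ + |d| + ‖w₁‖`
  have hA : ‖⟪y, R⟫_ℂ‖ ≤ t + ‖d‖ + ‖w₁‖ := by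
    rw [hinner0]
    have h1 : ‖(t : ℂ) + d * ((‖y‖ ^ 2 : ℝ) : ℂ)‖ ≤ t + ‖d‖ := by
      refine (norm_add_le _ _).trans ?_
      rw [Complex.norm_real, Real.norm_of_nonneg ht0.le, norm_mul, Complex.norm_real,
        Real.norm_of_nonneg (sq_nonneg _)]
      have : ‖d‖ * ‖y‖ ^ 2 ≤ ‖d‖ := mul_le_of_le_one_right (norm_nonneg _) (pow_le_one₀ (norm_nonneg _) hy1)
      linarith only [this]
    have h2 : ‖⟪y, w₁⟫_ℂ‖ ≤ ‖w₁‖ :=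
      (norm_inner_le_norm y w₁).trans (mul_le_of_le_one_left (norm_nonneg _) hy1)
    exact (norm_sub_le _ _).trans (by linarith only [h1, h2])
  -- `|⟨T^j y, R⟩| ≥ |⟨x₀ − y, T^j y⟩| − 10⁻²⁰(|d| + ‖w₁‖)`
  have hTjy : ‖(T ^ j) y‖ ≤ 1 / 10 ^ 20 := by
    calc ‖(T ^ j) y‖ ≤ ‖T‖ ^ j * ‖y‖ := norm_pow_apply_le T j y
      _ ≤ ‖T‖ ^ 1 * 1 := mul_le_mul (pow_le_pow_of_le_one (norm_nonneg _) hT1.le hj) hy1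
          (norm_nonneg _) (pow_nonneg (norm_nonneg _) 1)
      _ ≤ 1 / 10 ^ 20 := by rw [pow_one, mul_one]; exact hT
  have he : ‖d • y - w₁‖ ≤ ‖d‖ + ‖w₁‖ := by
    refine (norm_sub_le _ _).trans ?_
    rw [norm_smul]
    have : ‖d‖ * ‖y‖ ≤ ‖d‖ := mul_le_of_le_one_right (norm_nonneg _) hy1
    linarith only [this]
  have hB : ‖⟪x₀ - y, (T ^ j) y⟫_ℂ‖ - 1 / 10 ^ 20 * (‖d‖ + ‖w₁‖) ≤ ‖⟪(T ^ j) y, R⟫_ℂ‖ := by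
    have h1 : ‖⟪(T ^ j) y, d • y - w₁⟫_ℂ‖ ≤ 1 / 10 ^ 20 * (‖d‖ + ‖w₁‖) :=
      (norm_inner_le_norm _ _).trans
        (mul_le_mul hTjy he (norm_nonneg _) (by norm_num))
    have h2 : ‖⟪(T ^ j) y, x₀ - y⟫_ℂ‖ ≤ ‖⟪(T ^ j) y, R⟫_ℂ‖ + ‖⟪(T ^ j) y, d • y - w₁⟫_ℂ‖ := by
      have : ⟪(T ^ j) y, x₀ - y⟫_ℂ = ⟪(T ^ j) y, R⟫_ℂ - ⟪(T ^ j) y, d • y - w₁⟫_ℂ := by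
        rw [hsplit, inner_add_right]; ring
      rw [this]; exact norm_sub_le _ _
    have h3 : ‖⟪x₀ - y, (T ^ j) y⟫_ℂ‖ = ‖⟪(T ^ j) y, x₀ - y⟫_ℂ‖ := norm_inner_symm _ _
    linarith only [h1, h2, h3]
  -- the exact ratio and `|c_j| ≤ ‖Lc‖`
  have hid : ‖c j‖ * ‖⟪y, R⟫_ℂ‖ = ‖c 0‖ * ‖⟪(T ^ j) y, R⟫_ℂ‖ := by
    rw [hk0, hk j, norm_mul, norm_mul]; ring
  have hcj : ‖c j‖ ≤ ‖L c‖ := by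
    have h0 : c j = L c (j - 1) := by rw [Vy.L_apply, Nat.sub_add_cancel hj]
    rw [h0]; exact lp.norm_apply_le_norm (by norm_num) (L c) (j - 1)
  exact ⟨‖w₁‖, ‖d‖, norm_nonneg _, hw, norm_nonneg _, htδ, hc0', hA, hB, hid, hcj⟩

/-- **Case I forces `‖Lc‖ ≥ (εθ)⁵` for ALL `0 < εθ ≤ 10⁻³`.**  `‖T‖ ≤ 10⁻²⁰`, `⟨x₀ − y, y⟩ = εθ ∈ (0, 10⁻³]`,
`‖y‖ ≤ 1`, `‖x₀ − y‖ ≤ 1`, `‖x₀ − y‖ < ‖x₀‖`, Case I at some `j ≥ 1` (`|⟨x₀ − y, T^j y⟩| ≥ (εθ)⁴`); `c` THE minimal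
solution of (1) for `V_y` at radius `‖x₀ − y‖` (the infimum in (25)).  Then `(Σ_{i≥1}|c_i|²)^{1/2} = ‖Lc‖ ≥ (εθ)⁵`:
if `‖Lc‖ < (εθ)⁵` then in `kkt_ratio_core` `δ + u ≤ 4·10⁻²⁰(εθ)⁴`, so `|⟨y, R⟩| ≤ 1.001εθ`, `|⟨T^j y, R⟩| ≥ 0.999(εθ)⁴`,
`|c₀| ≥ 0.999`, and the ratio gives `(εθ)⁵ · 1.001εθ > |c_j|·|⟨y, R⟩| = |c₀|·|⟨T^j y, R⟩| ≥ 0.998(εθ)⁴`, absurd. [cite: Enflo2023, v2 p.12, Case I and eq. (25) (tex L386–L399); p.3, eq. (5)] -/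
theorem tail_ge_pow_five_of_caseI (T : H →L[ℂ] H) (hT1 : ‖T‖ < 1) (hT : ‖T‖ ≤ 1 / 10 ^ 20) (x₀ y : H)
    (t : ℝ) (ht : ⟪x₀ - y, y⟫_ℂ = t) (ht0 : 0 < t) (ht1 : t ≤ 1 / 10 ^ 3) (hy1 : ‖y‖ ≤ 1)
    (hxy : ‖x₀ - y‖ ≤ 1) (hlt : ‖x₀ - y‖ < ‖x₀‖) (hI : ∃ j, 1 ≤ j ∧ t ^ 4 ≤ ‖⟪x₀ - y, (T ^ j) y⟫_ℂ‖)
    {c : ℓ2} (hc : IsMinimal (V T hT1 y) x₀ ‖x₀ - y‖ c) :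
    t ^ 5 ≤ ‖L c‖ := by
  obtain ⟨j, hj, hz⟩ := hI
  obtain ⟨u, δ, hu0, hu, hδ0, htδ, hc0, hA, hB, hid, hcj⟩ :=
    kkt_ratio_core T hT1 hT x₀ y t ht ht0 hy1 hxy hlt hj hc
  by_contra hcon
  push Not at hcon
  have hA0 : 0 ≤ ‖⟪y, x₀ - V T hT1 y c⟫_ℂ‖ := norm_nonneg _
  have hB0 : 0 ≤ ‖⟪(T ^ j) y, x₀ - V T hT1 y c⟫_ℂ‖ := norm_nonneg _
  have ht4pos : 0 < t ^ 4 := pow_pos ht0 4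
  have ht4 : t ^ 4 ≤ 1 / 10 ^ 12 := (pow_le_pow_left₀ ht0.le ht1 4).trans (by norm_num)
  have ht54 : t ^ 5 ≤ t ^ 4 := pow_le_pow_of_le_one ht0.le (ht1.trans (by norm_num)) (by norm_num)
  -- `u ≤ 1.0001·10⁻²⁰ (εθ)⁵`, `δ ≤ 2.0002·10⁻²⁰ (εθ)⁴`
  have hu' : u ≤ 1 / 10 ^ 20 * (1 + 1 / 10 ^ 4) * t ^ 5 :=
    hu.trans (mul_le_mul_of_nonneg_left hcon.le (by norm_num))
  have hδ' : δ ≤ 2 * (1 / 10 ^ 20 * (1 + 1 / 10 ^ 4)) * t ^ 4 := by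
    refine le_of_mul_le_mul_left ?_ ht0
    calc t * δ ≤ 2 * u := htδ
      _ ≤ 2 * (1 / 10 ^ 20 * (1 + 1 / 10 ^ 4) * t ^ 5) := by linarith only [hu']
      _ = t * (2 * (1 / 10 ^ 20 * (1 + 1 / 10 ^ 4)) * t ^ 4) := by ring
  have hκ : δ + u ≤ 4 / 10 ^ 20 * t ^ 4 := by linarith only [hδ', hu', ht54, ht4pos]
  have hδ1 : δ ≤ 1 / 10 ^ 31 := by linarith only [hκ, ht4, hu0]
  have ht41 : t ^ 4 ≤ 1 / 10 ^ 9 * t := by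
    have h3 : t ^ 3 ≤ (1 / 10 ^ 3) ^ 3 := pow_le_pow_left₀ ht0.le ht1 3
    have : t ^ 4 = t ^ 3 * t := by ring
    rw [this]
    have := mul_le_mul_of_nonneg_right h3 ht0.le
    linarith only [this]
  -- the three estimates
  have hA' : ‖⟪y, x₀ - V T hT1 y c⟫_ℂ‖ ≤ 1001 / 1000 * t := by linarith only [hA, hκ, ht41, ht0]
  have hB' : 999 / 1000 * t ^ 4 ≤ ‖⟪(T ^ j) y, x₀ - V T hT1 y c⟫_ℂ‖ := by
    linarith only [hB, hz, hκ, ht4pos]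
  have hc0' : 999 / 1000 ≤ ‖c 0‖ := by linarith only [hc0, hδ1]
  -- the ratio
  have hR : 999 / 1000 * (999 / 1000 * t ^ 4) ≤ ‖c 0‖ * ‖⟪(T ^ j) y, x₀ - V T hT1 y c⟫_ℂ‖ :=
    calc 999 / 1000 * (999 / 1000 * t ^ 4) ≤ 999 / 1000 * ‖⟪(T ^ j) y, x₀ - V T hT1 y c⟫_ℂ‖ := by
          gcongr
      _ ≤ ‖c 0‖ * ‖⟪(T ^ j) y, x₀ - V T hT1 y c⟫_ℂ‖ := mul_le_mul_of_nonneg_right hc0' hB0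
  have hL : ‖c j‖ * ‖⟪y, x₀ - V T hT1 y c⟫_ℂ‖ ≤ t ^ 5 * (1001 / 1000 * t) :=
    calc ‖c j‖ * ‖⟪y, x₀ - V T hT1 y c⟫_ℂ‖ ≤ ‖L c‖ * ‖⟪y, x₀ - V T hT1 y c⟫_ℂ‖ :=
          mul_le_mul_of_nonneg_right hcj hA0
      _ ≤ t ^ 5 * ‖⟪y, x₀ - V T hT1 y c⟫_ℂ‖ := mul_le_mul_of_nonneg_right hcon.le hA0
      _ ≤ t ^ 5 * (1001 / 1000 * t) := mul_le_mul_of_nonneg_left hA' (pow_nonneg ht0.le 5)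
  have ht6 : t ^ 5 * (1001 / 1000 * t) ≤ 1001 / 1000 * (1 / 10 ^ 6) * t ^ 4 := by
    have h2 : t ^ 2 ≤ (1 / 10 ^ 3) ^ 2 := pow_le_pow_left₀ ht0.le ht1 2
    have hexp : t ^ 5 * (1001 / 1000 * t) = 1001 / 1000 * (t ^ 2 * t ^ 4) := by ring
    rw [hexp]
    have := mul_le_mul_of_nonneg_right h2 ht4pos.le
    linarith only [this]
  linarith only [hR, hL, hid, ht6, ht4pos]

/-- **The PRINTED (25) holds for THE minimiser on the whole range of the construction.**  Under the hypotheses of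
`tail_ge_pow_five_of_caseI` (`0 < εθ ≤ 10⁻³`, Case I at some `j ≥ 1`): `Σ_{i≥1}|c_i|² = ‖Lc‖² ≥ (εθ)^{10} ≥ (εθ)^{15}`.
This supersedes the range `εθ ≥ 2·10⁻⁶` of `eq25_printed_of_caseI`: the printed STATEMENT (25) is true as printed;
only the displayed competitor DERIVATION is too weak (it gives exponent `22`, `tail_lower_bound_of_caseI`). [cite: Enflo2023, v2 p.12, eq. (25)] -/
theorem eq25_printed_of_caseI_all (T : H →L[ℂ] H) (hT1 : ‖T‖ < 1) (hT : ‖T‖ ≤ 1 / 10 ^ 20) (x₀ y : H)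
    (t : ℝ) (ht : ⟪x₀ - y, y⟫_ℂ = t) (ht0 : 0 < t) (ht1 : t ≤ 1 / 10 ^ 3) (hy1 : ‖y‖ ≤ 1)
    (hxy : ‖x₀ - y‖ ≤ 1) (hlt : ‖x₀ - y‖ < ‖x₀‖) (hI : ∃ j, 1 ≤ j ∧ t ^ 4 ≤ ‖⟪x₀ - y, (T ^ j) y⟫_ℂ‖)
    {c : ℓ2} (hc : IsMinimal (V T hT1 y) x₀ ‖x₀ - y‖ c) :
    t ^ 15 ≤ ‖L c‖ ^ 2 := by
  have h := tail_ge_pow_five_of_caseI T hT1 hT x₀ y t ht ht0 ht1 hy1 hxy hlt hI hc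
  have h2 : (t ^ 5) ^ 2 ≤ ‖L c‖ ^ 2 := pow_le_pow_left₀ (pow_nonneg ht0.le 5) h 2
  calc t ^ 15 ≤ t ^ 10 := pow_le_pow_of_le_one ht0.le (ht1.trans (by norm_num)) (by norm_num)
    _ = (t ^ 5) ^ 2 := by ring
    _ ≤ ‖L c‖ ^ 2 := h2

/-- **The cubic order of the tail in Case I: `‖Lc‖ ≥ 0.99(εθ)³` for `10⁻¹⁸ ≤ εθ ≤ 10⁻³`.**  Same setting; if
`‖Lc‖ < 0.99(εθ)³` then `δ + u ≤ 4·10⁻²⁰(εθ)²`, `|⟨y, R⟩| ≤ 1.0001εθ`, `|⟨T^j y, R⟩| ≥ (εθ)⁴ − 4·10⁻⁴⁰(εθ)² ≥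
0.9996(εθ)⁴` (this is where `εθ ≥ 10⁻¹⁸` enters), `|c₀| ≥ 0.9999`, and the ratio gives
`0.99·1.0001(εθ)⁴ > 0.9995(εθ)⁴`, absurd.  (Heuristically `C ≈ εθ`, `c₀ ≈ 1`, so `|c_j| ≈ |⟨T^j y, x₀ − y⟩|/εθ ≥ (εθ)³`:
the exponent `3 = 4 − 1` is that of Case I's hypothesis minus one.) [cite: Enflo2023, v2 p.12, Case I and eq. (25); p.3, eq. (5)] -/
theorem tail_ge_cube_of_caseI (T : H →L[ℂ] H) (hT1 : ‖T‖ < 1) (hT : ‖T‖ ≤ 1 / 10 ^ 20) (x₀ y : H)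
    (t : ℝ) (ht : ⟪x₀ - y, y⟫_ℂ = t) (ht18 : 1 / 10 ^ 18 ≤ t) (ht1 : t ≤ 1 / 10 ^ 3) (hy1 : ‖y‖ ≤ 1)
    (hxy : ‖x₀ - y‖ ≤ 1) (hlt : ‖x₀ - y‖ < ‖x₀‖) (hI : ∃ j, 1 ≤ j ∧ t ^ 4 ≤ ‖⟪x₀ - y, (T ^ j) y⟫_ℂ‖)
    {c : ℓ2} (hc : IsMinimal (V T hT1 y) x₀ ‖x₀ - y‖ c) :
    99 / 100 * t ^ 3 ≤ ‖L c‖ := by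
  obtain ⟨j, hj, hz⟩ := hI
  have ht0 : 0 < t := lt_of_lt_of_le (by norm_num) ht18
  obtain ⟨u, δ, hu0, hu, hδ0, htδ, hc0, hA, hB, hid, hcj⟩ :=
    kkt_ratio_core T hT1 hT x₀ y t ht ht0 hy1 hxy hlt hj hc
  by_contra hcon
  push Not at hcon
  have hA0 : 0 ≤ ‖⟪y, x₀ - V T hT1 y c⟫_ℂ‖ := norm_nonneg _
  have hB0 : 0 ≤ ‖⟪(T ^ j) y, x₀ - V T hT1 y c⟫_ℂ‖ := norm_nonneg _
  have ht3pos : 0 < t ^ 3 := pow_pos ht0 3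
  have ht4pos : 0 < t ^ 4 := pow_pos ht0 4
  have ht2 : t ^ 2 ≤ 1 / 10 ^ 6 := (pow_le_pow_left₀ ht0.le ht1 2).trans (by norm_num)
  have ht32 : t ^ 3 ≤ t ^ 2 := pow_le_pow_of_le_one ht0.le (ht1.trans (by norm_num)) (by norm_num)
  have ht21 : t ^ 2 ≤ t := by
    have : t ^ 2 = t * t := by ring
    rw [this]; exact mul_le_of_le_one_right ht0.le (ht1.trans (by norm_num))
  -- `u ≤ 1.0001·10⁻²⁰ (εθ)³`, `δ ≤ 2.0002·10⁻²⁰ (εθ)²`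
  have hL3 : ‖L c‖ ≤ t ^ 3 := hcon.le.trans (by linarith only [ht3pos])
  have hu' : u ≤ 1 / 10 ^ 20 * (1 + 1 / 10 ^ 4) * t ^ 3 :=
    hu.trans (mul_le_mul_of_nonneg_left hL3 (by norm_num))
  have hδ' : δ ≤ 2 * (1 / 10 ^ 20 * (1 + 1 / 10 ^ 4)) * t ^ 2 := by
    refine le_of_mul_le_mul_left ?_ ht0
    calc t * δ ≤ 2 * u := htδ
      _ ≤ 2 * (1 / 10 ^ 20 * (1 + 1 / 10 ^ 4) * t ^ 3) := by linarith only [hu']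
      _ = t * (2 * (1 / 10 ^ 20 * (1 + 1 / 10 ^ 4)) * t ^ 2) := by ring
  have hκ : δ + u ≤ 4 / 10 ^ 20 * t ^ 2 := by linarith only [hδ', hu', ht32, pow_nonneg ht0.le 2]
  have hδ1 : δ ≤ 1 / 10 ^ 25 := by linarith only [hκ, ht2, hu0]
  have ht36 : 1 / 10 ^ 36 * t ^ 2 ≤ t ^ 4 := by
    have h := pow_le_pow_left₀ (by norm_num) ht18 2
    have hexp : t ^ 4 = t ^ 2 * t ^ 2 := by ring
    rw [hexp]
    have := mul_le_mul_of_nonneg_right h (pow_nonneg ht0.le 2)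
    linarith only [this]
  -- the three estimates
  have hA' : ‖⟪y, x₀ - V T hT1 y c⟫_ℂ‖ ≤ 10001 / 10000 * t := by linarith only [hA, hκ, ht21, ht0]
  have hB' : 9996 / 10000 * t ^ 4 ≤ ‖⟪(T ^ j) y, x₀ - V T hT1 y c⟫_ℂ‖ := by
    linarith only [hB, hz, hκ, ht36]
  have hc0' : 9999 / 10000 ≤ ‖c 0‖ := by linarith only [hc0, hδ1]
  -- the ratio
  have hR : 9999 / 10000 * (9996 / 10000 * t ^ 4) ≤ ‖c 0‖ * ‖⟪(T ^ j) y, x₀ - V T hT1 y c⟫_ℂ‖ :=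
    calc 9999 / 10000 * (9996 / 10000 * t ^ 4) ≤ 9999 / 10000 * ‖⟪(T ^ j) y, x₀ - V T hT1 y c⟫_ℂ‖ := by
          gcongr
      _ ≤ ‖c 0‖ * ‖⟪(T ^ j) y, x₀ - V T hT1 y c⟫_ℂ‖ := mul_le_mul_of_nonneg_right hc0' hB0
  have hL : ‖c j‖ * ‖⟪y, x₀ - V T hT1 y c⟫_ℂ‖ ≤ 99 / 100 * t ^ 3 * (10001 / 10000 * t) :=
    calc ‖c j‖ * ‖⟪y, x₀ - V T hT1 y c⟫_ℂ‖ ≤ ‖L c‖ * ‖⟪y, x₀ - V T hT1 y c⟫_ℂ‖ :=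
          mul_le_mul_of_nonneg_right hcj hA0
      _ ≤ 99 / 100 * t ^ 3 * ‖⟪y, x₀ - V T hT1 y c⟫_ℂ‖ := mul_le_mul_of_nonneg_right hcon.le hA0
      _ ≤ 99 / 100 * t ^ 3 * (10001 / 10000 * t) := mul_le_mul_of_nonneg_left hA' (by positivity)
  have hexp : 99 / 100 * t ^ 3 * (10001 / 10000 * t) = 99 / 100 * (10001 / 10000) * t ^ 4 := by ring
  rw [hexp] at hL
  linarith only [hR, hL, hid, ht4pos]

end CaseI

end Literature.Analysis.OperatorTheory.Enflo2023

end
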